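import Mathlib
import Summits.ValiantsHypothesis.ValiantsHypothesis.Theses.KPlusLogSqLaw

/-!
# Route «KPlusLogSqLaw» — α row, RESOLVED limit: `ClosedWindowLaw → DComb` (the whole-path window)

HONEST FRAMING.  Helper theorem for the two rank-9 SUPPORT items `DComb` (D^comb) and `ClosedWindowLaw` (cW) of
route-ValiantsHypothesis-KPlusLogSqLaw (seat pub-symmetroid-conjb-2 g17/g18; desk R2629 (A) / R2650; pre-image by conjb-2 g18,
filed by a prover seat `--supports <item> --as helper`).  Def-free, elementary, resolved (tropical) limit only: both items are typed
OPEN statements with hub-exact finite evidence (m ≤ 8) and are NOT asserted here — this file proves only the implication between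
them.  Nothing here is a root count; nothing bears on `WeakLifting` / `TropicalB`, on Conjecture B (`KPlusLogSqLaw`), on
`MatrixDescartes` or on VP ≠ VNP.

CONTENT.  `ClosedWindowLaw` bounds, for every edge window `[i, j] ⊆ [0, N)`, the number of odd blocks of a block-distinct positive
swap chain whose CLOSED neighbourhood lies in the window by `j + 1 - i`.  For the whole path `i = 0`, `j = N - 1` the neighbourhood
condition is vacuous, so the bound reads `#odd blocks ≤ N`, which is `DComb`; the degenerate case `N = 0` has no blocks at all
(a block is a nonempty set of edges).  Hall's theorem is NOT needed for this direction (it is needed only for the system of distinct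
representative edges, THEORY-NOTE-g17 §4.8(i)).  [this seat; elementary]
-/

-- `Summit.ValiantsHypothesis.ValiantsHypothesis.…` repeats a component by the D-0017 layout (single-conjunct summit); the name is mandated.
set_option linter.dupNamespace false

namespace Summit.ValiantsHypothesis.ValiantsHypothesis.Theorems.KPlusLogSqLaw.ResolvedDCombOfClosedWindow

open Summit.ValiantsHypothesis.ValiantsHypothesis.Theses.KPlusLogSqLaw (ClosedWindowLaw DComb)
open Finset

/-- `D^comb` is the whole-path window `[0, N-1]` of the closed-window law. -/
theorem dComb_of_closedWindowLaw (h : ClosedWindowLaw) : DComb := by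
  intro N L lam μ hlam hpm hblk hslope hdist
  rcases Nat.eq_zero_or_pos N with hN | hN
  · subst hN
    have : (univ.filter fun k : Fin L => Odd (symmDiff (μ k.castSucc) (μ k.succ)).card) = ∅ := by
      refine filter_eq_empty_iff.mpr ?_
      intro k _
      obtain ⟨e, _⟩ := (hblk k).1
      exact e.elim0
    rw [this, card_empty]
  · have hw := h N L lam μ hlam hpm hblk hslope hdist 0 (N - 1) (Nat.zero_le _) (by omega)
    have hfilt : (univ.filter fun k : Fin L =>
          Odd (symmDiff (μ k.castSucc) (μ k.succ)).card ∧
            ∀ e ∈ symmDiff (μ k.castSucc) (μ k.succ),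
              ((0 : ℕ) = 0 ∨ 0 + 1 ≤ e.val) ∧ (N - 1 + 1 = N ∨ e.val + 1 ≤ N - 1)) =
        (univ.filter fun k : Fin L => Odd (symmDiff (μ k.castSucc) (μ k.succ)).card) := by
      refine filter_congr ?_
      intro k _
      constructor
      · exact fun hk => hk.1
      · intro hk
        exact ⟨hk, fun e _ => ⟨Or.inl rfl, Or.inl (by omega)⟩⟩
    rw [hfilt] at hw
    have : N - 1 + 1 - 0 = N := by omega
    rw [this] at hw
    exact hw

end Summit.ValiantsHypothesis.ValiantsHypothesis.Theorems.KPlusLogSqLaw.ResolvedDCombOfClosedWindow
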